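import Summits.QuantumFields.QCD.Theorems.WilsonMobilityGapMobilityGapStubLightMoment
import Summits.QuantumFields.QCD.Theses.IntegerCriticalLine
import Literature.MathematicalPhysics.QuantumFieldTheory.QCDTimeReflection

/-!
# Sketch — crux-ideate round 2, ideator 5, crux `MobilityGap` (stmt-QuantumFields-9150)

First-lemma signatures (statements only; nothing here is an item) for the two crux idea cards
`unitary-index-jump-dichotomy` (§1–§3) and `free-rate-uv-anchor` (§4–§5).  Everything is stated
over existing declarations: the crux functional `MobilityGapSketch.fm` (E = 0, η = 0, phase-quenched
at the operator's OWN bare mass), `LightMomentFree` (the kernel-checked necessary core, p116312),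
`diracMatrix`/`diracMatrixAP`, `wilsonMeasure`, `afBeta`, and the sibling route items
`IntegerCriticalLine.CriticalLineExists` / `TrivialPlateauGap` (stmt-9692 / stmt-9694).
-/

noncomputable section

namespace Summit.QuantumFields.QCD.Cruxes.MobilityGap.Ideator5

open scoped BigOperators Topology
open MeasureTheory Filter Set
open Literature.MathematicalPhysics.QuantumFieldTheory Literature.MathematicalPhysics.QuantumLattice
  Literature.Probability.LatticeModels
open Summit.QuantumFields.QCD.Theorems.MobilityGapSketch

local notation "SU3" => Matrix.specialUnitaryGroup (Fin 3) ℂ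

/-! ### §1 The unitary Aizenman–Molchanov bound along the bare-mass axis (branch A′ negated)

`UniformAxisAMBound Nf β`: ONE set of constants `(s, C, c)` bounds the crux's own functional
`fm Nf β (fun _ => x) S f v s ≤ C e^{-c‖v‖∞}` for EVERY bare mass `x ∈ [−1, 1]`, every torus, every
flavour and every site of the box — PSB's MBGH (2.51) specialised to `E = 0`, `η → 0` already taken
(the crux's `fm` IS the `E = 0` Aizenman–Molchanov diagnostic of `Γ₅ D_W(x)`), under the
PHASE-QUENCHED measure `|det D_W(x)|^{N_f} dμ_W` at the operator's own mass (the "unitary" family: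
the disorder law moves with `x`, unlike the quenched `CriticalLineExists`). -/
def UniformAxisAMBound (Nf : ℕ) (β : ℝ) : Prop :=
  ∃ s C c : ℝ, 0 < s ∧ s < 1 ∧ 0 < c ∧ ∀ x : ℝ, -1 ≤ x → x ≤ 1 →
    ∀ (S : ℕ) (f : Fin Nf) (v : Site 4), v ∈ box 4 S →
      fm Nf β (fun _ => x) S f v s ≤ C * Real.exp (-(c * ‖v‖))

/-- Branch A′ at coupling `β` (typed, finite-volume, PSB Def. 2.4.3 style): the unitary family has a
DELOCALISED bare mass in `[−1, 1]` — no uniform AM bound of the crux functional across the window. -/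
def UnitaryDelocalisedMass (Nf : ℕ) (β : ℝ) : Prop :=
  ¬ UniformAxisAMBound Nf β

/-- The same uniform bound in PSB/Stoiber's MBGH currency (complex energies `E + iη`, `|E| ≤ E₀`, `η > 0`, one
flavour's Hermitian kernel `Γ₅D_W(x) − z`), still under the PHASE-QUENCHED law at the operator's own mass —
verbatim the integrand of `IntegerCriticalLine.CriticalLineExists` with `wilsonMeasure` reweighted by
`‖(diracMatrix U (fun _ ↦ x)).det‖ = |det D_W(x)|^{N_f}`.  This is the hypothesis the index machinery consumes. -/
def UniformAxisMBGH (Nf : ℕ) (β : ℝ) : Prop :=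
  ∃ s E₀ C c : ℝ, 0 < s ∧ s < 1 ∧ 0 < E₀ ∧ 0 < c ∧ ∀ x : ℝ, -1 ≤ x → x ≤ 1 →
    ∀ (S : ℕ) (E η : ℝ), |E| ≤ E₀ → 0 < η → ∀ v : Fin 4 → ℤ, (∀ i, |v i| ≤ S) →
      ∀ (a b : Fin 3) (α γ : Fin 4),
        (∫ U : GaugeConfig 4 (2 * S + 1) SU3,
            ‖(diracMatrix U (fun _ : Fin Nf => x)).det‖ *
              ‖(Literature.Barriers.QuantumFields.WilsonDeterminant.hermitianWilsonDirac
                    (fundamentalRep (Fin 3)) U x 1 -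
                  ((E : ℂ) + (η : ℂ) * Complex.I) •
                    (1 : Matrix (TorusSite 4 (2 * S + 1) × Fin 3 × Fin 4)
                      (TorusSite 4 (2 * S + 1) × Fin 3 × Fin 4) ℂ))⁻¹
                ((0 : TorusSite 4 (2 * S + 1)), a, α) (Torus.proj (2 * S + 1) v, b, γ)‖ ^ s
            ∂(wilsonMeasure (fundamentalRep (Fin 3)) β)) /
          (∫ U : GaugeConfig 4 (2 * S + 1) SU3,
            ‖(diracMatrix U (fun _ : Fin Nf => x)).det‖ ∂(wilsonMeasure (fundamentalRep (Fin 3)) β))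
        ≤ C * Real.exp (-(c * ∑ i, |(v i : ℝ)|))

/-- BRIDGE between the two currencies (first-lemma-level stub of the card): a uniform `E = 0`, `η = 0` bound of
the crux functional extends to a uniform MBGH on a small energy window (first resolvent identity + an a-priori
fractional-moment bound; standard in Aizenman–Molchanov theory modulo the decoupling step for Haar links). -/
def E0BoundGivesMBGH (Nf : ℕ) : Prop :=
  ∀ β : ℝ, UniformAxisAMBound Nf β → UniformAxisMBGH Nf β

/-! ### §2 Branch B′: a first-order jump of the phase-quenched state along the axis

The finite-volume phase-quenched PRESSURE `p_S(x) = (2S+1)^{-4} log ∫ |det D_W(U,x)|^{N_f} dμ_β(U)`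
(for the degenerate tuple the tree's `‖(diracMatrix U _).det‖` is exactly `|det D_W(x)|^{N_f}`), whose
`x`-derivative is `N_f` times the flavour-singlet scalar density `E_{|w|}[Re tr G(0,0)]`; a jump of the
derivative that survives the thermodynamic limit is the Sharpe–Singleton (first-order) branch, in which
the INDEX may change with the state and no delocalised bare mass is forced. -/
def pressure (Nf : ℕ) (β : ℝ) (S : ℕ) (x : ℝ) : ℝ :=
  Real.log (∫ U : GaugeConfig 4 (2 * S + 1) SU3,
      ‖(diracMatrix U (fun _ : Fin Nf => x)).det‖ ∂(wilsonMeasure (fundamentalRep (Fin 3)) β)) /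
    ((2 * (S : ℝ) + 1) ^ 4)

/-- Branch B′ at coupling `β`: somewhere in the window the scalar density jumps by `≥ δ` across
`x₁`, at every resolution `ε`, on arbitrarily large tori (a first-order transition of the
phase-quenched `N_f`-flavour Wilson theory in the bare mass). -/
def PhaseQuenchedStateJump (Nf : ℕ) (β : ℝ) : Prop :=
  ∃ x₁ δ : ℝ, -1 ≤ x₁ ∧ x₁ ≤ 1 ∧ 0 < δ ∧ ∀ ε : ℝ, 0 < ε →
    ∃ᶠ S : ℕ in atTop,
      δ ≤ deriv (pressure Nf β S) (x₁ + ε) - deriv (pressure Nf β S) (x₁ - ε)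

/-! ### §3 FIRST LEMMA of card `unitary-index-jump-dichotomy` and its consumer

The dichotomy is the unitary twin of `IntegerCriticalLine.CriticalLineExists` (stmt-9692, quenched,
complex energies): at every weak coupling EITHER the crux functional has no uniform AM bound across
the bare-mass window (a delocalised bare mass: the Aoki branch) OR the phase-quenched state jumps
(the Sharpe–Singleton branch).  Intended proof: the strong second Chern number of the Fermi projector
of `Γ₅D_W(x)` is `0` for `x > 0` (`TrivialPlateauGap`, pathwise) and `1` at `x = −1`
(`InteriorPlateauLocalisation` + free value), and is locally constant wherever MBGH holds for a
CONTINUOUSLY varying covariant family (PSB Cor. 6.5.2) — continuity of `x ↦ μ_x` is exactly `¬ B′`. -/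
def UnitaryIndexJumpDichotomy (Nf : ℕ) : Prop :=
  ∃ β₁ : ℝ, ∀ β : ℝ, β₁ ≤ β → ¬ UniformAxisMBGH Nf β ∨ PhaseQuenchedStateJump Nf β

/-- The crux-facing corollary (via the bridge): no uniform `E = 0` bound of `fm`, or a state jump. -/
theorem dichotomy_E0 {Nf : ℕ} (hD : UnitaryIndexJumpDichotomy Nf) (hB : E0BoundGivesMBGH Nf) :
    ∃ β₁ : ℝ, ∀ β : ℝ, β₁ ≤ β → UnitaryDelocalisedMass Nf β ∨ PhaseQuenchedStateJump Nf β := by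
  obtain ⟨β₁, h⟩ := hD
  refine ⟨β₁, fun β hβ => ?_⟩
  rcases h β hβ with hA | hJ
  · exact Or.inl fun hAM => hA (hB β hAM)
  · exact Or.inr hJ

/-- The dichotomy refines the quenched theorem: either branch is compatible with
`CriticalLineExists`, and the quenched family (x-independent law) has no branch B′ at all
(Kieburg–Splittorff–Verbaarschot: "the Sharpe–Singleton scenario is not possible in the quenched
theory").  Recorded as the expected implication between the sibling item and §1 for `N_f = 0`-like
reading; NOT claimed as a first lemma. -/
def QuenchedTwin : Prop :=
  Summit.QuantumFields.QCD.Theses.IntegerCriticalLine.CriticalLineExists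

/-- AXIS REGULARITY (the step that turns "no AM bound at any rate" into the core's `∀ n` lower bound;
`N_f = 2` via reflection positivity of `det²` on the restated pin, open for the non-RP `|det|³`):
at a coupling with a delocalised bare mass, for EVERY lattice rate `μ > 0` some bare mass
`x ∈ (−1, 1]` carries an axis lower bound `c e^{-μ n} ≤ fm` on all large tori (constants may depend
on `β`, `μ`). -/
def AxisRegularity (Nf : ℕ) : Prop :=
  ∀ β μ : ℝ, 0 < μ → UnitaryDelocalisedMass Nf β →
    ∃ x : ℝ, -1 < x ∧ x ≤ 1 ∧ ∃ s : ℝ, 0 < s ∧ s < 1 ∧ ∃ (f : Fin Nf) (c : ℝ), 0 < c ∧ ∃ S₀ : ℕ,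
      ∀ S : ℕ, S₀ ≤ S → ∀ n : ℕ, n ≤ S →
        c * Real.exp (-(μ * n)) ≤ fm Nf β (fun _ => x) S f (Pi.single 0 (n : ℤ)) s

/-- BRANCH A′ CLOSES THE CORE: if the Aoki branch occurs at an unbounded set of couplings, the
necessary core `LightMomentFree` follows (choose `β_k` in that set, `a_k := afBeta⁻¹`, rate `r a_k`
from `AxisRegularity` with `μ := r a_k`; the exponent `s` is made `k`-uniform by Lyapunov,
`lightMomentAt_mono`).  Pure logic + the two-loop profile's surjectivity onto large `β`. -/
def BranchAClosesCore (Nf : ℕ) : Prop :=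
  AxisRegularity Nf → (∀ β₁ : ℝ, ∃ β : ℝ, β₁ ≤ β ∧ UnitaryDelocalisedMass Nf β) → LightMomentFree Nf

/-- BRANCH B′ RESIDUAL (`JumpIsSmall`, honestly open): along an asymptotically free sequence on which
the state jumps, the jump point itself carries a light moment at rate `r a_k` — physically the
Sharpe–Singleton minimum pion mass `m_π,min ∼ aΛ²` (lattice rate `∼ a_k²  ≪ r a_k`); no exact lever
is claimed for it. -/
def JumpIsSmall (Nf : ℕ) : Prop :=
  ∀ (a β : ℕ → ℝ), (∀ k, 0 < a k) → Tendsto a atTop (𝓝 0) →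
    (∃ Λ > (0 : ℝ), Tendsto (fun k => β k - afBeta Nf Λ (a k)) atTop (𝓝 0)) →
    (∀ᶠ k in atTop, PhaseQuenchedStateJump Nf (β k)) →
      ∃ s : ℝ, 0 < s ∧ s < 1 ∧ LightMomentAt Nf a β s

/-! ### §4 Card `free-rate-uv-anchor`: the honest RP object and the chord transport

The reflection-positive object is the SLICE-SUMMED SECOND moment of the ANTIPERIODIC propagator on
an EVEN torus under `|det D^{AP}|^{N_f}` (for `N_f = 2` degenerate this is the honest pion correlator
`⟨P⁺(t) P⁻(0)⟩` at zero spatial momentum, `det² ≥ 0`). -/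
def pionAP (Nf : ℕ) (β x : ℝ) (S : ℕ) (f : Fin Nf) (t : ℕ) : ℝ :=
  (∫ U : GaugeConfig 4 (2 * S + 2) SU3,
      ‖(diracMatrixAP U (fun _ : Fin Nf => x)).det‖ *
        ∑ w : Fin 3 → Fin (2 * S + 2), ∑ a : Fin 3, ∑ i : Fin 4, ∑ b : Fin 3, ∑ j : Fin 4,
          ‖(diracMatrixAP U (fun _ : Fin Nf => x))⁻¹
              (quarkEquiv (f, (Torus.proj (2 * S + 2) 0, a, i)))
              (quarkEquiv (f, (Torus.proj (2 * S + 2)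
                (Fin.cons (t : ℤ) (fun k => ((w k : ℕ) : ℤ)) : Site 4), b, j)))‖ ^ 2
      ∂(wilsonMeasure (fundamentalRep (Fin 3)) β)) /
    (∫ U : GaugeConfig 4 (2 * S + 2) SU3,
      ‖(diracMatrixAP U (fun _ : Fin Nf => x)).det‖ ∂(wilsonMeasure (fundamentalRep (Fin 3)) β))

/-- CHORD TRANSPORT (pure real analysis, the classical RP tool): a positive log-convex sequence is
bounded below beyond `2n₀` by the geometric continuation of its `[n₀, 2n₀]` chord — one DOUBLING
ratio at scale `n₀` bounds the decay rate at all larger separations by `log(C n₀ / C (2n₀)) / n₀`. -/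
def ChordTransport : Prop :=
  ∀ C : ℕ → ℝ, (∀ n, 0 < C n) → (∀ n, C (n + 1) ^ 2 ≤ C n * C (n + 2)) →
    ∀ n₀ n : ℕ, 1 ≤ n₀ → 2 * n₀ ≤ n →
      C n₀ * (C (2 * n₀) / C n₀) ^ (((n : ℝ) - n₀) / n₀) ≤ C n

/-- FIRST LEMMA of card `free-rate-uv-anchor` (the UV doubling anchor, volume-uniform): along SOME
asymptotically free data, for every `r > 0` (free!), eventually in `k` there is a bare mass
`x ∈ (−1, K a_k]` at which the slice-summed AP pion correlator is two-sidedly controlled at the single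
deep-UV scale `n₀ = ⌈1/(r a_k)⌉` (physical distance `1/r → 0` as `r → ∞`, where the running coupling
is small): a DOUBLING bound `pionAP (2n₀) ≥ 2^{-p} pionAP n₀` and an amplitude floor, on all large
even tori.  With `ChordTransport` (RP log-convexity in `t`) this yields rate `≤ (p log 2) r a_k`. -/
def FreeRateUVAnchor (Nf : ℕ) : Prop :=
  ∃ a β : ℕ → ℝ, (∀ k, 0 < a k) ∧ Tendsto a atTop (𝓝 0) ∧
    (∃ Λ > (0 : ℝ), Tendsto (fun k => β k - afBeta Nf Λ (a k)) atTop (𝓝 0)) ∧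
    ∃ K p : ℝ, ∀ r : ℝ, 0 < r → ∀ᶠ k in atTop, ∃ x : ℝ, -1 < x ∧ x ≤ K * a k ∧
      ∃ (f : Fin Nf) (c : ℝ), 0 < c ∧ ∃ S₀ : ℕ, ∀ S : ℕ, S₀ ≤ S →
        c ≤ pionAP Nf (β k) x S f ⌈1 / (r * a k)⌉₊ ∧
          (2 : ℝ) ^ (-p) * pionAP Nf (β k) x S f ⌈1 / (r * a k)⌉₊ ≤
            pionAP Nf (β k) x S f (2 * ⌈1 / (r * a k)⌉₊)

/-! ### §5 Sanity: the trivial end of the index dichotomy is in the pool -/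

/-- The trivial plateau end (`x > 0`: pathwise gap, Chern number `0`) is the sibling support item. -/
def TrivialEnd : Prop :=
  Summit.QuantumFields.QCD.Theses.IntegerCriticalLine.TrivialPlateauGap

example : UnitaryIndexJumpDichotomy 2 → E0BoundGivesMBGH 2 → AxisRegularity 2 → BranchAClosesCore 2 →
    (∀ β₁ : ℝ, ∃ β : ℝ, β₁ ≤ β ∧ ¬ PhaseQuenchedStateJump 2 β) → LightMomentFree 2 := by
  intro hD hB hR hC hnoB
  obtain ⟨β₁, hβ⟩ := dichotomy_E0 hD hB
  refine hC hR fun β₂ => ?_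
  obtain ⟨β, hβle, hnb⟩ := hnoB (max β₁ β₂)
  refine ⟨β, (le_max_right _ _).trans hβle, ?_⟩
  rcases hβ β ((le_max_left _ _).trans hβle) with hA | hB
  · exact hA
  · exact absurd hB hnb

end Summit.QuantumFields.QCD.Cruxes.MobilityGap.Ideator5

end
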